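import Literature.MathematicalPhysics.QuantumFieldTheory.Balaban1983to89.B9Eq369Small
import Literature.MathematicalPhysics.QuantumFieldTheory.Balaban1983to89.B8Eq133Hypotheses
import Literature.MathematicalPhysics.QuantumFieldTheory.Balaban1983to89.B9SupplySockB9P3ZdAt

/-!
# `Balaban1983to89.B9Eq369CurvSmallZd` — [Balaban1985BackgroundPropagators] (3.10) p. 392 ∕ (3.69) p. 404 ON THE `ℤᵈ × 𝔸` CARRIER:
# THE GENUINE CURVATURE LETTER `Δ′(U₀)` (an OBJECT, `DpZd`) AND ITS BINDER (3.69) «`Δ′` is a small, bounded operator» PROVED —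
# `(Lʲη)³‖(Δ′(U₀)A)(b)‖ ≤ 14(d−1)·α₀·|A|₍₋₁₎` for `b ∈ Ω_j`, `j ≤ m`, whenever the plaquette variables of the unitary background `U₀`
# are `α₀L^{−2j}`-close to `1` on the plaquettes touching `Ω_j` (B8 (1.7): `U₀ ∈ 𝔄_m({Ω_j}, α₀)`)

statement-level skeleton of published theorems with citation tags; proofs where landed; nothing here is a claim about the
Yang–Mills mass gap

PDF held: `paper:balaban1985-cmp99-background-propagators` ([4] = B9; journal page = PDF page + 388), p. 392 (3.10), p. 404 (3.69);
`paper:balaban1985-cmp99-regular-spaces-gauge-fixing` (B8; journal page = PDF page + 74), p. 77 (1.7), p. 86 (1.55)–(1.59).  The displays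
are quoted verbatim in the headers of `B9Eq369Small` ((3.69), (3.10), (3.35)) and `B8Ineq132` ((1.7), (1.9)), imported BY NAME.

WHAT IS PRINTED.  [4] p. 392, after (3.10): *«We have written it this way because with our assumptions on the configuration U the operator
Δ′ will be a bounded, small operator, which will be treated as a small perturbation of D*D.»*  [4] p. 404, (3.69): *«From the formula (3.10) it
follows that Δ′(U′U) is a small perturbation itself in the sense that we have the bound |(Δ′(U′U)A′)(b)| ≤ O(1)(Mα₀ + α₁)(L^jη)⁻²|A′|, b ∈ Ω_j
(3.69) the supremum on the right-hand side is taken over bonds belonging to one of the plaquettes containing the bond b … This bound follows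
from the estimates |Re(U′U)(∂p) − 1|, |Im(U′U)(∂p)| ≤ O(1)(Mα₀ + α₁)ξ², ξ = L^{−j}.»*  B8 p. 77, (1.7): *«|U(∂p) − 1| < α₀L^{−2j} for p ∈ Ω_j,
j = 0, 1, …, k»* (the class `𝔄_k({Ω_j}, α₀)`); B8 p. 86: *«Theorem 3.3 of [4] implies the bounds (1.59)»* with the weighted norms `|·|₍γ₎`.

WHY THIS FILE (cell `pub-ymgap`, HUMAN RULING D-0062 ∕ D-0149 width push; seat `pub-ymgap-dag-n06-w2` (g0), node N06 = [B9]; count-neutral).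
The J-N06→N05 junction of `pub-ymgap-dag-n06-b` (`B9SupplySockB9P3ZdLetters(Omega)` ∕ `…ZdAt` ∕ `…ZdGamma`) reads [4] Sect. A at the `ℤᵈ × 𝔸`
carrier through a PARAMETER RECORD `OpsZd` of four operator letters (`Gop` = G(U₀), `Dp` = Δ′(U₀), `DRDs` = DR(U₀)D*, `QQ` = Q*aQ) and six
binders about them, and states (HONEST SCOPE (i) there): «LETTERS, NOT OBJECTS … proving them at this carrier = constructing [4] Sect. A … —
N06's object-bound».  Plan g77's `W-SEAT-START-LIST.md` § n06 item 4 asks for exactly that: «the letters G(U₀), Δ′(U₀), R(U₀), Q*ⱼ as operators +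
the six binders PROVED — start with ONE binder».  This file does the SECOND letter and its binder: `Δ′(U₀)` IS an object on this carrier — the
operator (3.10) of the tree's abstract-lattice leaf `B9Eq310Hermitian.deltaPrimeOp` (sites `S`, directions `ι`, shifts `T`, bond field `U`)
TRANSPORTED by r05's `B8Eq133Hypotheses.shiftT ∕ byDir` (`S := Site d`, `T κ := (· + e_κ)`, `U κ x := U₀ x κ`) — and its binder (3.69) is a
THEOREM, by the tree's pointwise (3.69) `B9Eq369Small.eq369` (lit-balaban lineage pv27; O(1) = 14(d − 1)) read through the dictionary
`plaqU (shiftT d) (byDir U₀) = B8Ineq132.plaqF U₀` and the side∕plaquette bookkeeping of `B8Eq140Level`.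

WHAT IS DECLARED ∕ PROVED (0 sorry; ONE `def`, everything else theorems; nothing of [4] asserted as a hypothesis-free fact beyond what is proved).
* §1 `DpZd η U₀ A` — THE LETTER Δ′(U₀) OF (3.10) ON `ℤᵈ`, in the argument order of `OpsZd.Dp` (`(U₀ : Site d → Fin d → 𝔸ˣ) → (Site d → Fin d →
  𝔸) → Site d → Fin d → 𝔸`); `DpZd_add`, `DpZd_smul` (ℂ-linearity), `DpZd_congr_local` (locality: `(Δ′A)(b)` reads `A` on the sides of the plaquettes
  through `b` only).
* §2 dictionary: `shiftT_symm_apply`, `plaqU_shiftT_byDir` ∕ `val_plaqU_shiftT_byDir` ([4]'s plaquette variable `U(∂p)` of the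
  transported model IS B8's `(∂U)(p_{κν}(y))`), `plaqNear_of_through` (pv27's `st(b)` ↦ r13's `PlaqNear`), `bondNear_of_through₁…₄`.
* §3 ★ `norm_DpZd_le_local` — PRINT'S (3.69), POINTWISE: `‖U₀(b′)^{±1}‖ ≤ 1`, `‖U₀(∂p) − 1‖ ≤ C·L^{−2j}` on the plaquettes through `b = ⟨x, x+e_μ⟩`
  and `‖A(b′)‖ ≤ a` on their sides ⟹ `‖(Δ′(U₀)A)(b)‖ ≤ 14(d−1)·C·(Lʲη)⁻²·a`; ★ `norm_DpZd_le_of_plaqSmall` (the plaquette hypothesis read on the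
  plaquettes TOUCHING `Ω_j` for a bond `b ∈ Ω_j` — B8's p. 77 convention); `norm_DpZd_le_of_inAk` (hypothesis = B8 (1.7) `InAk L m η α₀ Ω U₀`).
* §4 ★★ `scale3_norm_DpZd_le_msup_of_plaqSmall` ∕ `…_of_inAk` — THE BINDER'S CURRENCY: `(Lʲη)³‖(Δ′(U₀)A)(b)‖ ≤ 14(d−1)·C·|A|₍₋₁₎`, `|A|₍₋₁₎` =
  `B8ScaledSupNorm.msup L m η (−1)` over the sides of the plaquettes touching the `Ω_j` (the right-hand side of `CurvSmallDom` ∕ `CurvAt`), for a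
  bounded family (`Bdd`, as in `OnDom`).
* §5 ★★ `curvSmall_inAk_of_Dp_eq` — the binder `B9SupplySockB9P3ZdLettersOmega.CurvSmallDom` ∕ `B9SupplySockB9P3ZdAt.CurvAt` WITH ITS (3.35)
  HYPOTHESIS READ AS B8 (1.7) (`InAk`, the socket's own datum (1.33), first clause — what `Prop6Feed` consumes) HOLDS for every letter record with
  `(ops M i m).Dp = DpZd i.η`, at every member, constant `14(d−1)·α₀` (no `M`, no smallness, no `M₃ ∕ a₃`; `curvSmall_inAk_of_Dp_eq_M`: the
  literal `c69·M·α₀` shape for `M ≥ 1`); ★★ `curvAt_of_plaqReading` — the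
  member-local binder `CurvAt` ITSELF (its `Reg335` hypothesis kept) for any frame whose (3.35)-field at the member is READ as plaquette smallness
  `‖U₀(∂p) − 1‖ ≤ c·M·α₀·L^{−2j}` on the plaquettes touching `Ω_j`, `j ≤ m` (print p. 404: «the estimates follow directly from the assumptions
  (3.35)»; displayed as ONE hypothesis `hread` because the concrete frame's class `B9SupplySockB9P3ZdFrame.Reg335BodyZd` — (3.35) on the cube class
  `cubeClass396Zd` — does not cover the plaquettes of `Ω_j` from the `ZdIdx` axioms alone), constant `c69 := 14(d−1)·c`; `curvSmallDom_of_plaqReading`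
  (the family form).
* §6 sanity ∕ non-vacuity: `DpZd_one` (`Δ′(1) = 0`), `hypotheses_inhabited_one` (the class of §4–§5 is inhabited; B8 p. 98).

HONEST SCOPE.  (i) ONE OBJECT + an elementary perturbation bound: finite non-commutative algebra and triangle inequalities (pv27's), bookkeeping
here; the other three letters (`G(U₀) = (Ω₀Δ_aΩ₀)⁻¹` — [4] Thm 3.11's regime —, `DR(U₀)D*`, `Q*aQ`) stay parameters of `OpsZd`; nothing of [4]
Thm 3.1 ∕ 3.3 ∕ 3.11 is asserted.  (ii) The (3.35) ⇒ plaquette-smallness step for print's cube class is NOT re-derived here (tree: `B9Eq335Plaquette`,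
`B9SupplySockB9P3ZdInstance.reg335_bgZd_of_plaq_radii` is the converse direction); it is the displayed `hread`.  (iii) `d − 1` is natural
subtraction (`d = 0, 1`: no plaquettes, `Δ′ = 0`, constant `0`).  (iv) Count-neutral; N05 ∕ N06 NOT discharged; one finite lattice programme at
fixed `ε`; R4 closes the conditional finite-𝕋⁴ rung `BalabanLadder.UV` only; nothing continuum ∕ ℝ⁴ ∕ OS ∕ mass-gap ∕ Clay.  Unit
`pub-ymgap-dag-n06-w2` (g0), 2026-08-27.
-/

noncomputable section

namespace Literature.MathematicalPhysics.QuantumFieldTheory.Balaban1983to89.B9Eq369CurvSmallZd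

open B7Prop1Explicit (e hol plaqWord lplaqWord lplaqWord_true hol_lplaqWord U1 mem_U1)
open B7Prop2Explicit (unitaryUnits unitaryUnits_le_U1)
open B8Ineq132 (plaqF BondTouches PlaqTouches InAk)
open B8Eq140Level (IsSide PlaqNear BondNear SideTouches isSide₁ isSide₂ isSide₃ isSide₄ bondNear_of plaqTouches_of_plaqNear
  sideTouches_of_bondNear)
open B8ScaledSupNorm (weight msup Bdd weight_mul_norm_le_msup scale_pos)
open B8Eq133Hypotheses (shiftT byDir shiftT_apply)
open B8LeafModelZd (ZdIdx)
open B9Eq39Adjoint (plaqU)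
open B9Eq310Hermitian (deltaPrimeOp deltaPrimeOp_add deltaPrimeOp_smul)
open B9Eq369Small (Through eq369 deltaPrimeOp_congr_local)
open B9SupplySockB9P3ZdLetters (OpsZd)
open B9SupplySockB9P3ZdLettersOmega (OnDom CurvSmallDom)
open B9SupplySockB9P3ZdAt (CurvAt)

-- `Site` alone could resolve to the torus sites of `Setup.lean`; re-export the `ℤ^d` sites of `B7Prop1Explicit`.
export B7Prop1Explicit (Site)

variable {d : ℕ} {𝔸 : Type*} [CStarAlgebra 𝔸]

/-! ## §1 The letter `Δ′(U₀)` of (3.10) on the `ℤᵈ` carrier -/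

/-- **THE CURVATURE LETTER `Δ′(U₀)` OF (3.10) ON `ℤᵈ × 𝔸`** — `(Δ′(U₀)A)(⟨x, x+e_μ⟩)`, the operator of the tree's abstract-lattice leaf
(`B9Eq310Hermitian.deltaPrimeOp`: «Δ = D*D + Δ′ … the operator Δ′ will be a bounded, small operator») at the shifts `x ↦ x + e_κ` of `ℤᵈ` and
the bond field `U₀` read by direction (`B8Eq133Hypotheses.shiftT ∕ byDir`), in the argument order of `B9SupplySockB9P3ZdLetters.OpsZd.Dp`.
An OBJECT (not a parameter): the GENUINE second letter of the junction's record. [cite: Balaban1985BackgroundPropagators, (3.10) p.392, (3.69) p.404] -/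
def DpZd (η : ℝ) (U₀ : Site d → Fin d → 𝔸ˣ) (A : Site d → Fin d → 𝔸) : Site d → Fin d → 𝔸 :=
  fun x μ => deltaPrimeOp (shiftT d) (byDir U₀) η (byDir A) μ x

/-- unfolding `DpZd`. [cite: Balaban1985BackgroundPropagators, (3.10) p.392] -/
theorem DpZd_apply (η : ℝ) (U₀ : Site d → Fin d → 𝔸ˣ) (A : Site d → Fin d → 𝔸) (x : Site d) (μ : Fin d) :
    DpZd η U₀ A x μ = deltaPrimeOp (shiftT d) (byDir U₀) η (byDir A) μ x := rfl

/-- `byDir` of a sum is the sum. [cite: Balaban1985BackgroundPropagators, (3.10) p.392 (bookkeeping)] -/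
theorem byDir_add (A B : Site d → Fin d → 𝔸) : byDir (A + B) = byDir A + byDir B := rfl

/-- `byDir` of a scalar multiple. [cite: Balaban1985BackgroundPropagators, (3.10) p.392 (bookkeeping)] -/
theorem byDir_smul (c : ℂ) (A : Site d → Fin d → 𝔸) : byDir (c • A) = c • byDir A := rfl

/-- **`Δ′(U₀)` IS ADDITIVE** («a bounded … operator»). [cite: Balaban1985BackgroundPropagators, (3.10) p.392] -/
theorem DpZd_add (η : ℝ) (U₀ : Site d → Fin d → 𝔸ˣ) (A B : Site d → Fin d → 𝔸) :
    DpZd η U₀ (A + B) = DpZd η U₀ A + DpZd η U₀ B := by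
  funext x μ
  simp only [DpZd, Pi.add_apply, byDir_add, deltaPrimeOp_add]

/-- **`Δ′(U₀)` IS ℂ-HOMOGENEOUS**. [cite: Balaban1985BackgroundPropagators, (3.10) p.392] -/
theorem DpZd_smul (η : ℝ) (U₀ : Site d → Fin d → 𝔸ˣ) (c : ℂ) (A : Site d → Fin d → 𝔸) :
    DpZd η U₀ (c • A) = c • DpZd η U₀ A := by
  funext x μ
  simp only [DpZd, Pi.smul_apply, byDir_smul, deltaPrimeOp_smul]

/-! ## §2 Dictionary: shifts, plaquette variables, the plaquettes through a bond -/

/-- the inverse shift `T_κ⁻¹` of the transported model is `x ↦ x − e_κ` (companion of r05's `shiftT_apply`).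
[cite: Balaban1985BackgroundPropagators, (3.1) p.390 (bookkeeping)] -/
theorem shiftT_symm_apply (κ : Fin d) (x : Site d) : (shiftT d κ).symm x = x - e κ := by
  rw [Equiv.symm_apply_eq, shiftT_apply, sub_add_cancel]

/-- **[4]'s PLAQUETTE VARIABLE OF THE TRANSPORTED MODEL IS B8's `(∂U)(p_{κν}(x))`**: `U(∂p) = U(x,κ)U(x+e_κ,ν)U(x+e_ν,κ)⁻¹U(x,ν)⁻¹` is the
holonomy along `plaqWord κ ν` (as units). [cite: Balaban1985BackgroundPropagators, (3.1) p.390; Balaban1985RegularSpaces, (1.2) p.76] -/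
theorem plaqU_shiftT_byDir (U₀ : Site d → Fin d → 𝔸ˣ) (κ ν : Fin d) (x : Site d) :
    plaqU (shiftT d) (byDir U₀) κ ν x = hol U₀ x (plaqWord κ ν) := by
  rw [← lplaqWord_true, hol_lplaqWord]
  rfl

/-- the same in `𝔸`: `(plaqU … : 𝔸) = B8Ineq132.plaqF U₀ κ ν x`. [cite: Balaban1985BackgroundPropagators, (3.1) p.390; Balaban1985RegularSpaces, (1.2) p.76] -/
theorem val_plaqU_shiftT_byDir (U₀ : Site d → Fin d → 𝔸ˣ) (κ ν : Fin d) (x : Site d) :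
    ((plaqU (shiftT d) (byDir U₀) κ ν x : 𝔸ˣ) : 𝔸) = plaqF U₀ κ ν x := by
  rw [plaqU_shiftT_byDir]
  rfl

/-- **`st(b)` ↦ `PlaqNear`**: a (positively oriented) plaquette `p_{κν}(y)` through the bond `b = ⟨x, x+e_μ⟩` in pv27's sense (`Through`) has `b` as
a side in r13's sense (`PlaqNear μ x y κ ν`). [cite: Balaban1985BackgroundPropagators, p.404 (after (3.69), «st(b)»); Balaban1985RegularSpaces, (1.45) p.84] -/
theorem plaqNear_of_through {μ : Fin d} {x : Site d} {κ ν : Fin d} {y : Site d} (h : Through (shiftT d) μ x κ ν y) :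
    PlaqNear μ x y κ ν := by
  obtain ⟨hlt, hcase⟩ := h
  refine ⟨hlt.ne, ?_⟩
  rcases hcase with ⟨hνμ, hy | hy⟩ | ⟨hκμ, hy | hy⟩
  · exact Or.inr (Or.inr (Or.inr ⟨hy.symm, hνμ.symm⟩))
  · refine Or.inr (Or.inl ⟨?_, hνμ.symm⟩)
    rw [hy, shiftT_symm_apply, sub_add_cancel]
  · exact Or.inl ⟨hy.symm, hκμ.symm⟩
  · refine Or.inr (Or.inr (Or.inl ⟨?_, hκμ.symm⟩))
    rw [hy, shiftT_symm_apply, sub_add_cancel]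

/-- the first side `⟨y, y+e_κ⟩` of a plaquette through `b` is `BondNear b`. [cite: Balaban1985BackgroundPropagators, p.404 (after (3.69)); Balaban1985RegularSpaces, (1.45) p.84] -/
theorem bondNear_of_through₁ {μ : Fin d} {x : Site d} {κ ν : Fin d} {y : Site d} (h : Through (shiftT d) μ x κ ν y) :
    BondNear μ x y κ :=
  bondNear_of (plaqNear_of_through h) (isSide₁ y κ ν)

/-- the second side `⟨y+e_κ, y+e_κ+e_ν⟩` of a plaquette through `b` is `BondNear b`. [cite: Balaban1985BackgroundPropagators, p.404 (after (3.69)); Balaban1985RegularSpaces, (1.45) p.84] -/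
theorem bondNear_of_through₂ {μ : Fin d} {x : Site d} {κ ν : Fin d} {y : Site d} (h : Through (shiftT d) μ x κ ν y) :
    BondNear μ x (y + e κ) ν :=
  bondNear_of (plaqNear_of_through h) (isSide₂ y κ ν)

/-- the third side `⟨y+e_ν, y+e_ν+e_κ⟩` of a plaquette through `b` is `BondNear b`. [cite: Balaban1985BackgroundPropagators, p.404 (after (3.69)); Balaban1985RegularSpaces, (1.45) p.84] -/
theorem bondNear_of_through₃ {μ : Fin d} {x : Site d} {κ ν : Fin d} {y : Site d} (h : Through (shiftT d) μ x κ ν y) :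
    BondNear μ x (y + e ν) κ :=
  bondNear_of (plaqNear_of_through h) (isSide₃ y κ ν)

/-- the fourth side `⟨y, y+e_ν⟩` of a plaquette through `b` is `BondNear b`. [cite: Balaban1985BackgroundPropagators, p.404 (after (3.69)); Balaban1985RegularSpaces, (1.45) p.84] -/
theorem bondNear_of_through₄ {μ : Fin d} {x : Site d} {κ ν : Fin d} {y : Site d} (h : Through (shiftT d) μ x κ ν y) :
    BondNear μ x y ν :=
  bondNear_of (plaqNear_of_through h) (isSide₄ y κ ν)

/-- **LOCALITY OF THE LETTER**: `(Δ′(U₀)A)(b)` depends on `A` only through its values on the sides of the plaquettes through `b` (print: «the supremum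
… is taken over bonds belonging to one of the plaquettes containing the bond b»). [cite: Balaban1985BackgroundPropagators, (3.69) p.404, (3.10) p.392] -/
theorem DpZd_congr_local (η : ℝ) (U₀ : Site d → Fin d → 𝔸ˣ) {A A' : Site d → Fin d → 𝔸} {x : Site d} {μ : Fin d}
    (hA : ∀ y τ, BondNear μ x y τ → A y τ = A' y τ) : DpZd η U₀ A x μ = DpZd η U₀ A' x μ :=
  deltaPrimeOp_congr_local (shiftT d) (byDir U₀) η μ x fun _ _ _ h =>
    ⟨hA _ _ (bondNear_of_through₁ h), hA _ _ (bondNear_of_through₂ h), hA _ _ (bondNear_of_through₃ h),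
      hA _ _ (bondNear_of_through₄ h)⟩

/-! ## §3 (3.69) for the letter, pointwise -/

variable [Nontrivial 𝔸]

/-- a unitary bond field is unit-bounded with unit-bounded inverses, in the transported model's indexing.
[cite: Balaban1985BackgroundPropagators, p.396 («U has values in G»)] -/
theorem norm_byDir_le_one {U₀ : Site d → Fin d → 𝔸ˣ} (hU₀ : ∀ x κ, U₀ x κ ∈ unitaryUnits 𝔸) (κ : Fin d) (x : Site d) :
    ‖((byDir U₀ κ x : 𝔸ˣ) : 𝔸)‖ ≤ 1 ∧ ‖(((byDir U₀ κ x)⁻¹ : 𝔸ˣ) : 𝔸)‖ ≤ 1 :=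
  mem_U1.mp (unitaryUnits_le_U1 (hU₀ x κ))

/-- ★ **PRINT'S (3.69) FOR THE LETTER `Δ′(U₀)`, POINTWISE ON `ℤᵈ`**: for a unitary background whose plaquette variables satisfy `‖U₀(∂p) − 1‖ ≤
C·L^{−2j}` on the plaquettes through the bond `b = ⟨x, x+e_μ⟩`, and a bond field with `‖A(b′)‖ ≤ a` on the sides of those plaquettes,
`‖(Δ′(U₀)A)(b)‖ ≤ 14(d−1)·C·(Lʲη)⁻²·a` — pv27's `B9Eq369Small.eq369` through the §2 dictionary.
[cite: Balaban1985BackgroundPropagators, (3.69) p.404, (3.10) p.392] -/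
theorem norm_DpZd_le_local {U₀ : Site d → Fin d → 𝔸ˣ} (hU₀ : ∀ x κ, U₀ x κ ∈ unitaryUnits 𝔸) {η a C L : ℝ} {j : ℕ}
    (A : Site d → Fin d → 𝔸) (x : Site d) (μ : Fin d) (hA : ∀ y τ, BondNear μ x y τ → ‖A y τ‖ ≤ a)
    (hplaq : ∀ y κ ν, PlaqNear μ x y κ ν → ‖plaqF U₀ κ ν y - 1‖ ≤ C * ((L ^ j)⁻¹) ^ 2) :
    ‖DpZd η U₀ A x μ‖ ≤ (14 * ((d - 1 : ℕ) : ℝ)) * C * ((L ^ j * η) ^ 2)⁻¹ * a := by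
  have h := eq369 (shiftT d) (byDir U₀) (norm_byDir_le_one hU₀) (A := byDir A) (η := η) (a := a) (C := C) (L := L)
    (j := j) μ x
    (fun _ _ _ h => ⟨hA _ _ (bondNear_of_through₁ h), hA _ _ (bondNear_of_through₂ h), hA _ _ (bondNear_of_through₃ h),
      hA _ _ (bondNear_of_through₄ h)⟩)
    (fun κ ν y h => by rw [val_plaqU_shiftT_byDir]; exact hplaq y κ ν (plaqNear_of_through h))
  simpa only [DpZd, Fintype.card_fin] using h

/-- ★ **(3.69) FROM PLAQUETTE SMALLNESS ON `Ω_j`** (B8 p. 77 convention: the plaquettes with a corner in `Ω_j`): for `b ∈ Ω_j` every plaquette through `b`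
touches `Ω_j`, so `‖U₀(∂p) − 1‖ ≤ C·L^{−2j}` on those plaquettes gives `‖(Δ′(U₀)A)(b)‖ ≤ 14(d−1)·C·(Lʲη)⁻²·a`.
[cite: Balaban1985BackgroundPropagators, (3.69) p.404; Balaban1985RegularSpaces, p.77 (plaquette convention)] -/
theorem norm_DpZd_le_of_plaqSmall {U₀ : Site d → Fin d → 𝔸ˣ} (hU₀ : ∀ x κ, U₀ x κ ∈ unitaryUnits 𝔸) {η a C L : ℝ} {j : ℕ}
    {Ω : Set (Site d)} (hplaq : ∀ (y : Site d) (κ ν : Fin d), κ ≠ ν → PlaqTouches Ω y κ ν → ‖plaqF U₀ κ ν y - 1‖ ≤ C * ((L ^ j)⁻¹) ^ 2)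
    (A : Site d → Fin d → 𝔸) {x : Site d} {μ : Fin d} (hb : BondTouches Ω x μ) (hA : ∀ y τ, BondNear μ x y τ → ‖A y τ‖ ≤ a) :
    ‖DpZd η U₀ A x μ‖ ≤ (14 * ((d - 1 : ℕ) : ℝ)) * C * ((L ^ j * η) ^ 2)⁻¹ * a :=
  norm_DpZd_le_local hU₀ A x μ hA fun y κ ν hq => hplaq y κ ν hq.1 (plaqTouches_of_plaqNear hb hq)

/-- ★ **(3.69) IN B8's CLASS `𝔄_m({Ω_j}, α₀)`** ((1.7): `|U₀(∂p) − 1| < α₀L^{−2j}` for the plaquettes of `Ω_j`, `j ≤ m` — the first clause of the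
socket's datum (1.33)): for `b ∈ Ω_j`, `j ≤ m`, `‖(Δ′(U₀)A)(b)‖ ≤ 14(d−1)·α₀·(Lʲη)⁻²·a`.
[cite: Balaban1985BackgroundPropagators, (3.69) p.404; Balaban1985RegularSpaces, (1.7) p.77, (1.33) p.82] -/
theorem norm_DpZd_le_of_inAk {U₀ : Site d → Fin d → 𝔸ˣ} (hU₀ : ∀ x κ, U₀ x κ ∈ unitaryUnits 𝔸) {L m : ℕ} {η α₀ : ℝ}
    {Ω : ℕ → Set (Site d)} (hreg : InAk L m η α₀ Ω U₀) {j : ℕ} (hj : j ≤ m) (A : Site d → Fin d → 𝔸) {x : Site d} {μ : Fin d}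
    (hb : BondTouches (Ω j) x μ) {a : ℝ} (hA : ∀ y τ, BondNear μ x y τ → ‖A y τ‖ ≤ a) :
    ‖DpZd η U₀ A x μ‖ ≤ (14 * ((d - 1 : ℕ) : ℝ)) * α₀ * (((L : ℝ) ^ j * η) ^ 2)⁻¹ * a :=
  norm_DpZd_le_of_plaqSmall hU₀ (fun y κ ν hκν hp => ((hreg j hj).1 y κ ν hκν hp).le) A hb hA

/-! ## §4 (3.69) in the weighted currency of the binder: `(Lʲη)³‖(Δ′A)(b)‖ ≤ 14(d−1)·C·|A|₍₋₁₎` -/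

/-- the weight of exponent `−1` at level `j` is the scale `Lʲη` itself. [cite: Balaban1985RegularSpaces, p.86 (definition after (1.55))] -/
theorem weight_neg_one (L : ℕ) (η : ℝ) (j : ℕ) : weight L η (-(1 : ℝ)) j = (L : ℝ) ^ j * η := by
  unfold weight
  rw [neg_neg, Real.rpow_one]

omit [Nontrivial 𝔸] in
/-- **the sides of the plaquettes through a bond of `Ω_j` are read by `|A|₍₋₁₎` at weight `Lʲη`**: for a bounded family, `b ∈ Ω_j`, `j ≤ m` and
`b′` a side of a plaquette through `b`, `‖A(b′)‖ ≤ |A|₍₋₁₎·(Lʲη)⁻¹`. [cite: Balaban1985RegularSpaces, (1.41) p.83, p.86 (definition after (1.55))] -/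
theorem norm_le_msup_div_scale {L m : ℕ} (hL : 1 ≤ L) {η : ℝ} (hη : 0 < η) {Ω : ℕ → Set (Site d)} {A : Site d → Fin d → 𝔸}
    (hB : Bdd L m η (-(1 : ℝ)) (fun j (b : Site d × Fin d) => SideTouches (Ω j) b.1 b.2) (fun b => A b.1 b.2))
    {j : ℕ} (hj : j ≤ m) {x : Site d} {μ : Fin d} (hb : BondTouches (Ω j) x μ) {y : Site d} {τ : Fin d} (hn : BondNear μ x y τ) :
    ‖A y τ‖ ≤ msup L m η (-(1 : ℝ)) (fun j (b : Site d × Fin d) => SideTouches (Ω j) b.1 b.2) (fun b => A b.1 b.2) / ((L : ℝ) ^ j * η) := by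
  have hs : 0 < (L : ℝ) ^ j * η := scale_pos hL hη j
  rw [le_div_iff₀ hs, mul_comm]
  have h := weight_mul_norm_le_msup hB hj (i := (y, τ)) (sideTouches_of_bondNear hb hn)
  rwa [weight_neg_one] at h

/-- ★★ **(3.69) IN THE BINDER'S CURRENCY, from plaquette smallness**: `U₀` unitary with `‖U₀(∂p) − 1‖ ≤ C·L^{−2j}` on the plaquettes of `Ω_j`, `A`
with bounded weighted family (the `Bdd` half of `OnDom`), `b ∈ Ω_j`, `j ≤ m` ⟹ `(Lʲη)³‖(Δ′(U₀)A)(b)‖ ≤ 14(d−1)·C·|A|₍₋₁₎` — the right-hand side of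
`CurvSmallDom` ∕ `CurvAt` with `c69·M·α₀ ↦ 14(d−1)·C`. [cite: Balaban1985BackgroundPropagators, (3.69) p.404, (3.41) p.397; Balaban1985RegularSpaces, (1.59) p.86] -/
theorem scale3_norm_DpZd_le_msup_of_plaqSmall {L m : ℕ} (hL : 1 ≤ L) {η : ℝ} (hη : 0 < η) {U₀ : Site d → Fin d → 𝔸ˣ}
    (hU₀ : ∀ x κ, U₀ x κ ∈ unitaryUnits 𝔸) {Ω : ℕ → Set (Site d)} {C : ℝ} {j : ℕ} (hj : j ≤ m)
    (hplaq : ∀ (y : Site d) (κ ν : Fin d), κ ≠ ν → PlaqTouches (Ω j) y κ ν → ‖plaqF U₀ κ ν y - 1‖ ≤ C * (((L : ℝ) ^ j)⁻¹) ^ 2)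
    {A : Site d → Fin d → 𝔸} (hB : Bdd L m η (-(1 : ℝ)) (fun j (b : Site d × Fin d) => SideTouches (Ω j) b.1 b.2) (fun b => A b.1 b.2))
    {x : Site d} {μ : Fin d} (hb : BondTouches (Ω j) x μ) :
    ((L : ℝ) ^ j * η) ^ 3 * ‖DpZd η U₀ A x μ‖ ≤
      (14 * ((d - 1 : ℕ) : ℝ)) * C * msup L m η (-(1 : ℝ)) (fun j (b : Site d × Fin d) => SideTouches (Ω j) b.1 b.2) (fun b => A b.1 b.2) := by
  set N := msup L m η (-(1 : ℝ)) (fun j (b : Site d × Fin d) => SideTouches (Ω j) b.1 b.2) (fun b => A b.1 b.2) with hN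
  have hs : 0 < (L : ℝ) ^ j * η := scale_pos hL hη j
  have h := norm_DpZd_le_of_plaqSmall hU₀ (η := η) hplaq A hb (fun y τ hn => norm_le_msup_div_scale hL hη hB hj hb hn)
  calc ((L : ℝ) ^ j * η) ^ 3 * ‖DpZd η U₀ A x μ‖
      ≤ ((L : ℝ) ^ j * η) ^ 3 * ((14 * ((d - 1 : ℕ) : ℝ)) * C * (((L : ℝ) ^ j * η) ^ 2)⁻¹ * (N / ((L : ℝ) ^ j * η))) :=
        mul_le_mul_of_nonneg_left h (pow_nonneg hs.le 3)
    _ = (14 * ((d - 1 : ℕ) : ℝ)) * C * N := by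
        field_simp

/-- ★★ **(3.69) IN THE BINDER'S CURRENCY, in B8's class `𝔄_m({Ω_j}, α₀)`**: `(Lʲη)³‖(Δ′(U₀)A)(b)‖ ≤ 14(d−1)·α₀·|A|₍₋₁₎` for `b ∈ Ω_j`, `j ≤ m`.
[cite: Balaban1985BackgroundPropagators, (3.69) p.404, (3.41) p.397; Balaban1985RegularSpaces, (1.7) p.77, (1.59) p.86] -/
theorem scale3_norm_DpZd_le_msup_of_inAk {L m : ℕ} (hL : 1 ≤ L) {η : ℝ} (hη : 0 < η) {U₀ : Site d → Fin d → 𝔸ˣ}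
    (hU₀ : ∀ x κ, U₀ x κ ∈ unitaryUnits 𝔸) {Ω : ℕ → Set (Site d)} {α₀ : ℝ} (hreg : InAk L m η α₀ Ω U₀) {j : ℕ} (hj : j ≤ m)
    {A : Site d → Fin d → 𝔸} (hB : Bdd L m η (-(1 : ℝ)) (fun j (b : Site d × Fin d) => SideTouches (Ω j) b.1 b.2) (fun b => A b.1 b.2))
    {x : Site d} {μ : Fin d} (hb : BondTouches (Ω j) x μ) :
    ((L : ℝ) ^ j * η) ^ 3 * ‖DpZd η U₀ A x μ‖ ≤
      (14 * ((d - 1 : ℕ) : ℝ)) * α₀ * msup L m η (-(1 : ℝ)) (fun j (b : Site d × Fin d) => SideTouches (Ω j) b.1 b.2) (fun b => A b.1 b.2) :=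
  scale3_norm_DpZd_le_msup_of_plaqSmall hL hη hU₀ hj (fun y κ ν hκν hp => ((hreg j hj).1 y κ ν hκν hp).le) hB hb

/-! ## §5 The binders of the junction for a letter record carrying the genuine `Δ′` -/

section Binders

variable {L : ℕ}

/-- ★★ **THE BINDER (3.69) WITH ITS (3.35) HYPOTHESIS READ AS B8 (1.7)** — `CurvSmallDom` ∕ `CurvAt` with `Reg335 ↦ InAk` (the socket's own datum
(1.33), first clause; what `B9SupplySockB9P3ZdLetters.Prop6Feed` consumes) — HOLDS FOR EVERY LETTER RECORD WHOSE `Dp` IS THE GENUINE `Δ′`, at every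
member `(M, i, m)` (`L ≥ 1`), with the constant `14(d−1)·α₀`: no `M`, no `M₃ ∕ a₃`, no smallness of `α₀`.
[cite: Balaban1985BackgroundPropagators, (3.69) p.404, (3.41) p.397; Balaban1985RegularSpaces, (1.7) p.77, (1.33) p.82, (1.59) p.86] -/
theorem curvSmall_inAk_of_Dp_eq (hL : 1 ≤ L) {ops : ℝ → ZdIdx d L → ℕ → OpsZd d 𝔸}
    (hDp : ∀ (M : ℝ) (i : ZdIdx d L) (m : ℕ), (ops M i m).Dp = DpZd i.η)
    (M : ℝ) (i : ZdIdx d L) (m : ℕ) (α₀ : ℝ) (U₀ : Site d → Fin d → 𝔸ˣ) (hU₀ : ∀ x κ, U₀ x κ ∈ unitaryUnits 𝔸)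
    (hreg : InAk L m i.η α₀ i.Ω U₀) (A : Site d → Fin d → 𝔸) (hA : OnDom L m i.η i.Ω A) {j : ℕ} (hj : j ≤ m)
    (x : Site d) (μ : Fin d) (hb : BondTouches (i.Ω j) x μ) :
    ((L : ℝ) ^ j * i.η) ^ 3 * ‖(ops M i m).Dp U₀ A x μ‖ ≤
      (14 * ((d - 1 : ℕ) : ℝ)) * α₀ *
        msup L m i.η (-(1 : ℝ)) (fun j (b : Site d × Fin d) => SideTouches (i.Ω j) b.1 b.2) (fun b => A b.1 b.2) := by
  rw [hDp]
  exact scale3_norm_DpZd_le_msup_of_inAk hL i.hη hU₀ hreg hj hA.2 hb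

/-- the same in the binder's literal constant shape `c69·M·α₀` (for `M ≥ 1`, `α₀ ≥ 0`; `c69 = 14(d−1)`): the body of `CurvAt` with `Reg335 ↦ InAk`.
[cite: Balaban1985BackgroundPropagators, (3.69) p.404, (3.41) p.397; Balaban1985RegularSpaces, (1.7) p.77, (1.59) p.86] -/
theorem curvSmall_inAk_of_Dp_eq_M (hL : 1 ≤ L) {ops : ℝ → ZdIdx d L → ℕ → OpsZd d 𝔸}
    (hDp : ∀ (M : ℝ) (i : ZdIdx d L) (m : ℕ), (ops M i m).Dp = DpZd i.η)
    {M : ℝ} (hM : 1 ≤ M) (i : ZdIdx d L) (m : ℕ) {α₀ : ℝ} (hα₀ : 0 ≤ α₀) (U₀ : Site d → Fin d → 𝔸ˣ)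
    (hU₀ : ∀ x κ, U₀ x κ ∈ unitaryUnits 𝔸) (hreg : InAk L m i.η α₀ i.Ω U₀) (A : Site d → Fin d → 𝔸) (hA : OnDom L m i.η i.Ω A)
    {j : ℕ} (hj : j ≤ m) (x : Site d) (μ : Fin d) (hb : BondTouches (i.Ω j) x μ) :
    ((L : ℝ) ^ j * i.η) ^ 3 * ‖(ops M i m).Dp U₀ A x μ‖ ≤
      (14 * ((d - 1 : ℕ) : ℝ)) * M * α₀ *
        msup L m i.η (-(1 : ℝ)) (fun j (b : Site d × Fin d) => SideTouches (i.Ω j) b.1 b.2) (fun b => A b.1 b.2) := by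
  have hN := B8ScaledSupNorm.msup_nonneg L m i.hη.le (-(1 : ℝ)) (fun j (b : Site d × Fin d) => SideTouches (i.Ω j) b.1 b.2)
    (fun b => A b.1 b.2)
  refine (curvSmall_inAk_of_Dp_eq hL hDp M i m α₀ U₀ hU₀ hreg A hA hj x μ hb).trans (mul_le_mul_of_nonneg_right ?_ hN)
  calc (14 * ((d - 1 : ℕ) : ℝ)) * α₀ = (14 * ((d - 1 : ℕ) : ℝ)) * 1 * α₀ := by rw [mul_one]
    _ ≤ (14 * ((d - 1 : ℕ) : ℝ)) * M * α₀ := by gcongr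

variable {I : Type} (geo : I → B9.Geometry) (bg : I → B9.Backgrounds)
variable (mem : ℝ → ZdIdx d L → ℕ → I)
variable (ιCfg : ∀ (M : ℝ) (i : ZdIdx d L) (m : ℕ) (U₀ : Site d → Fin d → 𝔸ˣ),
  (∀ x κ, U₀ x κ ∈ unitaryUnits 𝔸) → (bg (mem M i m)).Cfg)

/-- ★★ **THE MEMBER-LOCAL BINDER `CurvAt` ITSELF FOR THE GENUINE `Δ′`**, for any [B9] frame whose (3.35)-field at the member `(M, i, m)` is READ as
plaquette smallness on the plaquettes of the `Ω_j`, `j ≤ m`: `‖U₀(∂p) − 1‖ ≤ c·M·α₀·L^{−2j}` (print p. 404: «the estimates follow directly from the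
assumptions (3.35)» — displayed as the hypothesis `hread`; for print's cube class it is `B9Eq335Plaquette.b7_52_of_b9_335` on the covering cubes).
Then `CurvAt … ops c35 a₃ (14(d−1)·c) M i m`. [cite: Balaban1985BackgroundPropagators, (3.69) p.404, (3.35) p.396, (3.41) p.397] -/
theorem curvAt_of_plaqReading (hL : 1 ≤ L) {ops : ℝ → ZdIdx d L → ℕ → OpsZd d 𝔸} {c35 a₃ c : ℝ} {M : ℝ} {i : ZdIdx d L}
    {m : ℕ} (hDp : (ops M i m).Dp = DpZd i.η)
    (hread : ∀ (α₀ : ℝ) (U₀ : Site d → Fin d → 𝔸ˣ) (hU₀ : ∀ x κ, U₀ x κ ∈ unitaryUnits 𝔸), 0 < α₀ → M * α₀ ≤ a₃ →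
      (bg (mem M i m)).Reg335 c35 α₀ (ιCfg M i m U₀ hU₀) →
      ∀ j, j ≤ m → ∀ (y : Site d) (κ ν : Fin d), κ ≠ ν → PlaqTouches (i.Ω j) y κ ν →
        ‖plaqF U₀ κ ν y - 1‖ ≤ c * M * α₀ * (((L : ℝ) ^ j)⁻¹) ^ 2) :
    CurvAt bg L mem ιCfg ops c35 a₃ (14 * ((d - 1 : ℕ) : ℝ) * c) M i m := by
  intro α₀ U₀ hU₀ hα₀ hMa hR A hA j hj x μ hb
  rw [hDp]
  have h := scale3_norm_DpZd_le_msup_of_plaqSmall hL i.hη hU₀ hj (hread α₀ U₀ hU₀ hα₀ hMa hR j hj) hA.2 hb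
  calc ((L : ℝ) ^ j * i.η) ^ 3 * ‖DpZd i.η U₀ A x μ‖
      ≤ (14 * ((d - 1 : ℕ) : ℝ)) * (c * M * α₀) *
          msup L m i.η (-(1 : ℝ)) (fun j (b : Site d × Fin d) => SideTouches (i.Ω j) b.1 b.2) (fun b => A b.1 b.2) := h
    _ = 14 * ((d - 1 : ℕ) : ℝ) * c * M * α₀ *
          msup L m i.η (-(1 : ℝ)) (fun j (b : Site d × Fin d) => SideTouches (i.Ω j) b.1 b.2) (fun b => A b.1 b.2) := by ring

/-- **THE FAMILY BINDER `CurvSmallDom` FOR THE GENUINE `Δ′`** under the same reading at every member with `M ≥ M₃`.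
[cite: Balaban1985BackgroundPropagators, (3.69) p.404, (3.35) p.396, (3.41) p.397] -/
theorem curvSmallDom_of_plaqReading (hL : 1 ≤ L) {ops : ℝ → ZdIdx d L → ℕ → OpsZd d 𝔸} {c35 M₃ a₃ c : ℝ}
    (hDp : ∀ (M : ℝ) (i : ZdIdx d L) (m : ℕ), (ops M i m).Dp = DpZd i.η)
    (hread : ∀ (M : ℝ) (i : ZdIdx d L) (m : ℕ), M₃ ≤ M →
      ∀ (α₀ : ℝ) (U₀ : Site d → Fin d → 𝔸ˣ) (hU₀ : ∀ x κ, U₀ x κ ∈ unitaryUnits 𝔸), 0 < α₀ → M * α₀ ≤ a₃ →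
      (bg (mem M i m)).Reg335 c35 α₀ (ιCfg M i m U₀ hU₀) →
      ∀ j, j ≤ m → ∀ (y : Site d) (κ ν : Fin d), κ ≠ ν → PlaqTouches (i.Ω j) y κ ν →
        ‖plaqF U₀ κ ν y - 1‖ ≤ c * M * α₀ * (((L : ℝ) ^ j)⁻¹) ^ 2) :
    CurvSmallDom bg L mem ιCfg ops c35 M₃ a₃ (14 * ((d - 1 : ℕ) : ℝ) * c) :=
  fun M i m hM => curvAt_of_plaqReading bg mem ιCfg hL (hDp M i m) (hread M i m hM)

end Binders

/-! ## §6 Sanity ∕ non-vacuity: the letter vanishes at the flat background; the hypothesis class is inhabited -/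

omit [Nontrivial 𝔸] in
/-- **`Δ′(1) = 0`**: at the flat background every plaquette variable is `1`, so `z(p) = y(p) = 0` and the letter vanishes identically (print,
p. 392: (3.10) is «generalizing the operator ∂*∂ in the Abelian case» — the curvature part is absent at `U = 1`).  Consistency of the OBJECT with
(3.10), and the `C = 0` instance of §3. [cite: Balaban1985BackgroundPropagators, (3.10) p.392] -/
theorem DpZd_one (η : ℝ) (A : Site d → Fin d → 𝔸) : DpZd η (1 : Site d → Fin d → 𝔸ˣ) A = 0 := by
  funext x μ
  change deltaPrimeOp (shiftT d) (fun (_ : Fin d) (_ : Site d) => (1 : 𝔸ˣ)) η (byDir A) μ x = 0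
  have hp : ∀ κ ν y, plaqU (shiftT d) (fun (_ : Fin d) (_ : Site d) => (1 : 𝔸ˣ)) κ ν y = 1 := by
    intro κ ν y; simp [plaqU]
  have hz : ∀ κ ν y, B9Eq310Hermitian.zP (shiftT d) (fun (_ : Fin d) (_ : Site d) => (1 : 𝔸ˣ)) η κ ν y = 0 := by
    intro κ ν y
    simp only [B9Eq310Hermitian.zP, hp, B9Eq37Insertion.reC, Units.val_one, inv_one, B9Eq369Small.half_smul_one_add_one,
      sub_self, smul_zero]
  have hy : ∀ κ ν y, B9Eq310Hermitian.yP (shiftT d) (fun (_ : Fin d) (_ : Site d) => (1 : 𝔸ˣ)) η κ ν y = 0 := by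
    intro κ ν y
    simp only [B9Eq310Hermitian.yP, hp, B9Eq37Insertion.imC, Units.val_one, inv_one, sub_self, smul_zero]
  have hJ : ∀ κ ν, B9Eq310Hermitian.jordanF (shiftT d) (fun (_ : Fin d) (_ : Site d) => (1 : 𝔸ˣ)) η (byDir A) κ ν = 0 := by
    intro κ ν; funext y; simp [B9Eq310Hermitian.jordanF, hz]
  have hG₁ : ∀ κ ν, B9Eq310Hermitian.commG₁ (shiftT d) (fun (_ : Fin d) (_ : Site d) => (1 : 𝔸ˣ)) η (byDir A) κ ν = 0 := by
    intro κ ν; funext y; simp [B9Eq310Hermitian.commG₁, hy]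
  have hG₂ : ∀ κ ν, B9Eq310Hermitian.commG₂ (shiftT d) (fun (_ : Fin d) (_ : Site d) => (1 : 𝔸ˣ)) η (byDir A) κ ν = 0 := by
    intro κ ν; funext y; simp [B9Eq310Hermitian.commG₂, hy]
  have hG₃ : ∀ κ ν, B9Eq310Hermitian.commG₃ (shiftT d) (fun (_ : Fin d) (_ : Site d) => (1 : 𝔸ˣ)) η (byDir A) κ ν = 0 := by
    intro κ ν; funext y; simp [B9Eq310Hermitian.commG₃, hy]
  have hG₄ : ∀ κ ν, B9Eq310Hermitian.commG₄ (shiftT d) (fun (_ : Fin d) (_ : Site d) => (1 : 𝔸ˣ)) η (byDir A) κ ν = 0 := by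
    intro κ ν; funext y; simp [B9Eq310Hermitian.commG₄, hy]
  simp [deltaPrimeOp, B9Eq39Adjoint.divP, B9Eq310Hermitian.divL, hJ, hG₁, hG₂, hG₃, hG₄, B9Eq39Adjoint.covDstar, B9Eq39Adjoint.R]

omit [Nontrivial 𝔸] in
/-- **THE HYPOTHESIS SET OF §4–§5 IS INHABITED** (A6): the flat background `U₀ ≡ 1` is unitary and lies in B8's class `𝔄_m({Ω_j}, α₀)` for every
`α₀ > 0` (B8 p. 98 «The configuration … identically equal to 1 satisfies, of course, all possible regularity conditions»; tree:
`B8Prop6OfThm4.one_inAk`), and the zero field has a bounded weighted family — so `scale3_norm_DpZd_le_msup_of_inAk` ∕ `curvSmall_inAk_of_Dp_eq`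
quantify over an inhabited class (genuinely curved inhabitants: any unitary `U₀` with `‖U₀(∂p) − 1‖ < α₀L^{−2j}` on the plaquettes of `Ω_j`, by
definition of (1.7)). [cite: Balaban1985RegularSpaces, (1.7) p.77, p.98; Balaban1985BackgroundPropagators, (3.35) p.396] -/
theorem hypotheses_inhabited_one {L : ℕ} (hL : 1 ≤ L) (m : ℕ) {η α₀ : ℝ} (hη : 0 < η) (hα₀ : 0 < α₀) (Ω : ℕ → Set (Site d)) :
    (∀ (x : Site d) (κ : Fin d), (1 : Site d → Fin d → 𝔸ˣ) x κ ∈ unitaryUnits 𝔸) ∧ InAk L m η α₀ Ω (1 : Site d → Fin d → 𝔸ˣ) ∧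
      Bdd L m η (-(1 : ℝ)) (fun j (b : Site d × Fin d) => SideTouches (Ω j) b.1 b.2)
        (fun b => (0 : Site d → Fin d → 𝔸) b.1 b.2) :=
  ⟨fun _ _ => (unitaryUnits 𝔸).one_mem, B8Prop6OfThm4.one_inAk hL m hη hα₀ Ω,
    ⟨0, fun _ _ _ _ => by simp only [Pi.zero_apply, norm_zero, mul_zero, le_refl]⟩⟩

end Literature.MathematicalPhysics.QuantumFieldTheory.Balaban1983to89.B9Eq369CurvSmallZd

end
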